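import Literature.Geometry.Lorentzian.CoordRicciEvolution
import Literature.Geometry.Lorentzian.CoordEntropyEvolution
import HarnessLib

/-!
# The curvature pairing `B(β, γ) = ⟨Rm ∗ γ, β⟩` of bilinear forms, in coordinates
# (Hamilton 1982, §§7, 10, 11)

A further layer of the coordinate tensor calculus (`CoordCurvature`, `CoordBochner`,
`CoordEntropyEvolution`, `CoordRicciEvolution`): metric components `G : E → (E →L E →L ℝ)`,
smooth, symmetric and nondegenerate on an open set `V` (`IsMetricOn G V`; no positivity is
used), `R = riemAt G x`, `Ric = ricAt G x`, `S = scalAt G x`, `♯ = sharpAt G x`, a basis `b` of `E`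
with dual basis `bᵏ = b.coord k` and inverse metric coefficients `g^{ij} = ginv G b x i j`, the
metric pairing `⟨α, β⟩ = pairAt G x α β` and square norm `|β|² = normSqAt G x β` of bilinear forms.

The **curvature pairing** of two bilinear forms `β, γ` at `x` is the scalar

  `B(β, γ) := Σᵢⱼ g^{ij} Σ_k bᵏ( ♯( (β.flip bⱼ) ∘ R(bᵢ, ♯(γ b_k)) ) ) = Σᵢⱼ g^{ij} ⟨ρᵢⱼ, γ⟩`,
  `ρᵢⱼ(Y, Z) = β(R(bᵢ, Y)Z, bⱼ)`,

the term `Rm ∗ Ric` of the evolution of the Ricci tensor (Hamilton 1982, Cor. 7.3: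
`2 g^{pr} g^{qs} R_{piqk} R_{rs}`; Topping 2006, (2.5.4)) paired with a second form; it is kept
inline (no definition is introduced). We prove:

* `IsMetricOn.curvPair_eq_sum` — `B(β,γ) = Σ g^{ij} g^{kl} β(R(bᵢ, ♯γ(b_k))b_l, bⱼ)`, and
  `IsMetricOn.curvPair_eq_sum_sharpAt` — `B(β,γ) = Σ g^{kl} g^{ij} G(R(♯β(bᵢ), ♯γ(b_k))b_l, bⱼ)` for
  symmetric `β` (the raised form `Rm(β♯ ·, γ♯ ·, ·, ·)` doubly contracted);
* `IsMetricOn.sum_ginv_apply_riemAt_eq_ricAt'` — `Σ g^{ij} G(R(bᵢ,Y)Z, bⱼ) = Ric(Y,Z)`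
  (O'Neill 1983, Ch. 3, Lemma 3.52);
* `IsMetricOn.curvPair_metric_left` — **`B(G, γ) = ⟨Ric, γ⟩`**;
* `IsMetricOn.curvPair_comm` — **`B(β, γ) = B(γ, β)`** for symmetric `β, γ` (pair symmetry and the
  skew-symmetries of `Rm`, O'Neill 1983, Ch. 3, Prop. 3.36);
* `IsMetricOn.curvPair_sub_smul_left` — linearity in the first slot;
* `IsMetricOn.reaction_traceless_decomposition` — in dimension `4`, with `E = Ric − (S/4)G`,
  **`4B(Ric,Ric) − S|Ric|² = 4B(E,E) + S|E|²`** (Hamilton 1982, Lemma 10.5 / Huisken 1985,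
  Lemma 4.2: the reaction terms of `∂ₜ|Ric|²` and `∂ₜ S` regrouped on the traceless Ricci tensor).

Support file for Hamilton 1982 §11 (the gradient estimate for the scalar curvature,
Thm. 11.1, via Lemmas 11.2–11.6) used by the crux `ChangGurskyYang` of the route
SmoothPoincare4/EntropyRung (item stmt-SmoothPoincare4-10834, line margerin-cone-hamilton-rails,
stub `stub_gradientEstimates`). Everything is proved by finite index calculus in the basis `b`;
no definition and no statement of `Prop` type is introduced.

## References

* R. S. Hamilton, *Three-manifolds with positive Ricci curvature*, J. Differential Geom. 17
  (1982), §7 (Cor. 7.3), §10 (Lemma 10.5), §11 (Lemmas 11.2–11.6, Thm. 11.1). [Hamilton1982]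
* G. Huisken, *Ricci deformation of the metric on a Riemannian manifold*, J. Differential Geom. 21
  (1985), §4 (Lemmas 4.2, 4.3). [Huisken1985]
* B. O'Neill, *Semi-Riemannian geometry with applications to relativity*, Academic Press 1983,
  Ch. 3, Prop. 3.36, Lemma 3.52, pp. 60–61. [ONeill1983]
* P. Topping, *Lectures on the Ricci flow*, LMS Lecture Note Series 325, CUP 2006, §2,
  (2.5.4). [Topping2006]
-/

noncomputable section

set_option maxSynthPendingDepth 3

open Set Filter ContinuousLinearMap Module
open scoped Topology ContDiff

namespace Literature.Geometry.Lorentzian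

namespace MetricCoord

variable {E : Type*} [NormedAddCommGroup E] [NormedSpace ℝ E] [FiniteDimensional ℝ E]
  [CompleteSpace E]

namespace IsMetricOn

variable {G : E → E →L[ℝ] E →L[ℝ] ℝ} {V : Set E} {x : E} {ι : Type*} [Fintype ι] (b : Basis ι ℝ E)

/-! ### Reindexing helpers -/

/-- Reindexing a fourfold sum: `Σ_{ijmn} f(i,j,m,n) = Σ_{ijmn} f(m,n,j,i)`. [folklore] -/
theorem sum_reindex₄ (f : ι → ι → ι → ι → ℝ) :
    ∑ i, ∑ j, ∑ m, ∑ n, f i j m n = ∑ i, ∑ j, ∑ m, ∑ n, f m n j i :=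
  (sum_comm_pairs f).trans Finset.sum_comm

omit [CompleteSpace E] in
/-- Exchange of two metric contractions:
`Σ_{ij} g^{ij} Σ_{kl} g^{kl} T_{ijkl} = Σ_{kl} g^{kl} Σ_{ij} g^{ij} T_{ijkl}`. [folklore] -/
theorem sum_ginv_mul_sum_comm (T : ι → ι → ι → ι → ℝ) :
    ∑ i, ∑ j, ginv G b x i j * ∑ k, ∑ l, ginv G b x k l * T i j k l =
      ∑ k, ∑ l, ginv G b x k l * ∑ i, ∑ j, ginv G b x i j * T i j k l := by
  simp only [Finset.mul_sum]
  calc ∑ i, ∑ j, ∑ k, ∑ l, ginv G b x i j * (ginv G b x k l * T i j k l)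
      = ∑ k, ∑ l, ∑ i, ∑ j, ginv G b x i j * (ginv G b x k l * T i j k l) :=
        sum_comm_pairs fun i j k l ↦ ginv G b x i j * (ginv G b x k l * T i j k l)
    _ = ∑ k, ∑ l, ∑ i, ∑ j, ginv G b x k l * (ginv G b x i j * T i j k l) :=
        Finset.sum_congr rfl fun k _ ↦ Finset.sum_congr rfl fun l _ ↦
          Finset.sum_congr rfl fun i _ ↦ Finset.sum_congr rfl fun j _ ↦ mul_left_comm _ _ _

/-! ### The curvature pairing in the basis -/

omit [CompleteSpace E] in
/-- **The curvature pairing in the basis**: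
`B(β, γ) = Σ_{ij} g^{ij} Σ_{kl} g^{kl} β(R(bᵢ, ♯γ(b_k)) b_l, bⱼ)` (`bᵏ(♯α) = Σ_l g^{kl} α(b_l)`).
[cite: Hamilton1982, §7, Cor. 7.3] -/
theorem curvPair_eq_sum (β γ : E →L[ℝ] E →L[ℝ] ℝ) :
    ∑ i, ∑ j, ginv G b x i j * ∑ k, b.coord k (sharpAt G x
        ((β.flip (b j)).comp (riemAt G x (b i) (sharpAt G x (γ (b k))))))
      = ∑ i, ∑ j, ginv G b x i j * ∑ k, ∑ l, ginv G b x k l *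
          β (riemAt G x (b i) (sharpAt G x (γ (b k))) (b l)) (b j) := by
  refine Finset.sum_congr rfl fun i _ ↦ Finset.sum_congr rfl fun j _ ↦ ?_
  congr 1
  refine Finset.sum_congr rfl fun k _ ↦ ?_
  rw [coord_sharpAt_eq_sum b]
  simp only [ContinuousLinearMap.comp_apply, ContinuousLinearMap.flip_apply]

omit [CompleteSpace E] in
/-- **`Σ_{ij} g^{ij} G(R(bᵢ, Y)Z, bⱼ) = Ric(Y, Z)`**: the trace `Ric(Y,Z) = tr (X ↦ R(X,Y)Z)` computed
through the metric (O'Neill 1983, Ch. 3, Lemma 3.52: `Ric = C¹₃ R`; the reversed form of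
`ricAt_eq_sum_ginv`). [cite: ONeill1983, Ch. 3, Lemma 3.52] -/
theorem sum_ginv_apply_riemAt_eq_ricAt' (hG : IsMetricOn G V) (hx : x ∈ V) (Y Z : E) :
    ∑ i, ∑ j, ginv G b x i j * G x (riemAt G x (b i) Y Z) (b j) = ricAt G x Y Z :=
  (ricAt_eq_sum_ginv b (hG.isInvertible x hx) Y Z).symm

omit [CompleteSpace E] in
/-- **`B(G, γ) = ⟨Ric, γ⟩_G`**: for `β = G` the forms `Σ g^{ij} ρᵢⱼ = Σ g^{ij} G(R(bᵢ,·)·, bⱼ)` sum to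
`Ric`, and `⟨Ric, γ⟩ = Σ_k bᵏ(♯ Ric(♯γ(b_k), ·)) = Σ_{kl} g^{kl} Ric(♯γ(b_k), b_l)` (the pairing of
the `Rm ∗ Ric` term of Hamilton 1982, Cor. 7.3 with the metric). [cite: Hamilton1982, §7, Cor. 7.3] -/
theorem curvPair_metric_left (hG : IsMetricOn G V) (hx : x ∈ V) (γ : E →L[ℝ] E →L[ℝ] ℝ) :
    ∑ i, ∑ j, ginv G b x i j * ∑ k, b.coord k (sharpAt G x
        (((G x).flip (b j)).comp (riemAt G x (b i) (sharpAt G x (γ (b k))))))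
      = pairAt G x (ricAt G x) γ := by
  have hi := hG.isInvertible x hx
  rw [curvPair_eq_sum b, pairAt_eq_sum_coord b,
    sum_ginv_mul_sum_comm b fun i j k l ↦
      G x (riemAt G x (b i) (sharpAt G x (γ (b k))) (b l)) (b j)]
  refine Finset.sum_congr rfl fun k _ ↦ ?_
  rw [coord_sharpAt_eq_sum b]
  refine Finset.sum_congr rfl fun l _ ↦ ?_
  rw [ricAt_eq_sum_ginv b hi]

omit [CompleteSpace E] in
/-- **Moving a raised symmetric form across a metric contraction**:
`Σ_{ij} g^{ij} F(bᵢ, ♯β(bⱼ,·)) = Σ_{ij} g^{ij} F(♯β(bᵢ,·), bⱼ)` for a bilinear `F` and symmetric `β`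
(both sides equal `Σ g^{ij} g^{mn} β(bⱼ,b_n) F(bᵢ,b_m)`; `g^{ij}` and `β` symmetric).
[cite: ONeill1983, Ch. 3, pp. 60–61] -/
theorem sum_ginv_apply_sharpAt_comm (hG : IsMetricOn G V) (hx : x ∈ V) (F : E →L[ℝ] E →L[ℝ] ℝ)
    {β : E →L[ℝ] E →L[ℝ] ℝ} (hβ : ∀ v w, β v w = β w v) :
    ∑ i, ∑ j, ginv G b x i j * F (b i) (sharpAt G x (β (b j))) =
      ∑ i, ∑ j, ginv G b x i j * F (sharpAt G x (β (b i))) (b j) := by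
  have hi := hG.isInvertible x hx
  have hs := hG.symm x hx
  calc ∑ i, ∑ j, ginv G b x i j * F (b i) (sharpAt G x (β (b j)))
      = ∑ i, ∑ j, ∑ m, ∑ n,
          ginv G b x i j * ginv G b x m n * β (b j) (b n) * F (b i) (b m) := by
        refine Finset.sum_congr rfl fun i _ ↦ Finset.sum_congr rfl fun j _ ↦ ?_
        rw [sharpAt_eq_sum b (β (b j))]
        simp only [map_sum, map_smul, smul_eq_mul, Finset.mul_sum, Finset.sum_mul]
        refine Finset.sum_congr rfl fun m _ ↦ Finset.sum_congr rfl fun n _ ↦ ?_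
        ring
    _ = ∑ i, ∑ j, ∑ m, ∑ n,
          ginv G b x m n * ginv G b x j i * β (b n) (b i) * F (b m) (b j) :=
        sum_reindex₄ fun i j m n ↦ ginv G b x i j * ginv G b x m n * β (b j) (b n) * F (b i) (b m)
    _ = ∑ i, ∑ j, ginv G b x i j * F (sharpAt G x (β (b i))) (b j) := by
        refine Finset.sum_congr rfl fun i _ ↦ Finset.sum_congr rfl fun j _ ↦ ?_
        rw [sharpAt_eq_sum b (β (b i))]
        simp only [map_sum, map_smul, smul_eq_mul, FunLike.coe_sum, Finset.sum_apply,
          _root_.smul_apply, Finset.mul_sum, Finset.sum_mul]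
        refine Finset.sum_congr rfl fun m _ ↦ Finset.sum_congr rfl fun n _ ↦ ?_
        rw [ginv_comm b hi hs j i, hβ (b n) (b i)]
        ring

omit [CompleteSpace E] in
/-- **The curvature pairing with both forms raised**: for symmetric `β`,
`B(β, γ) = Σ_{kl} g^{kl} Σ_{ij} g^{ij} G(R(♯β(bᵢ,·), ♯γ(b_k,·)) b_l, bⱼ)`, i.e.
`B(β,γ) = g^{kl} g^{ij} Rm(β♯bᵢ, γ♯b_k, b_l, bⱼ)` (`β(v, bⱼ) = G(v, ♯β(bⱼ,·))`, then the raised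
form is moved across the contraction in `i, j`). [cite: Hamilton1982, §7, Cor. 7.3] -/
theorem curvPair_eq_sum_sharpAt (hG : IsMetricOn G V) (hx : x ∈ V) (γ : E →L[ℝ] E →L[ℝ] ℝ)
    {β : E →L[ℝ] E →L[ℝ] ℝ} (hβ : ∀ v w, β v w = β w v) :
    ∑ i, ∑ j, ginv G b x i j * ∑ k, b.coord k (sharpAt G x
        ((β.flip (b j)).comp (riemAt G x (b i) (sharpAt G x (γ (b k))))))
      = ∑ k, ∑ l, ginv G b x k l * ∑ i, ∑ j, ginv G b x i j *
          G x (riemAt G x (sharpAt G x (β (b i))) (sharpAt G x (γ (b k))) (b l)) (b j) := by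
  have hi := hG.isInvertible x hx
  have hs := hG.symm x hx
  have h2 : ∀ (Y : E) (l : ι), ∑ i, ∑ j, ginv G b x i j * β (riemAt G x (b i) Y (b l)) (b j) =
      ∑ i, ∑ j, ginv G b x i j * G x (riemAt G x (sharpAt G x (β (b i))) Y (b l)) (b j) := by
    intro Y l
    have key := sum_ginv_apply_sharpAt_comm b hG hx
      ((G x).comp (LinearMap.toContinuousLinearMap (ricciEndo G x Y (b l)))) hβ
    simp only [ContinuousLinearMap.comp_apply, LinearMap.coe_toContinuousLinearMap',
      ricciEndo_apply] at key
    rw [← key]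
    refine Finset.sum_congr rfl fun i _ ↦ Finset.sum_congr rfl fun j _ ↦ ?_
    rw [apply_apply_sharpAt hi hs, hβ]
  rw [curvPair_eq_sum b,
    sum_ginv_mul_sum_comm b fun i j k l ↦ β (riemAt G x (b i) (sharpAt G x (γ (b k))) (b l)) (b j)]
  simp only [h2]

/-- **Symmetry of the doubly contracted curvature in two families of vectors**:
`Σ g^{kl} g^{ij} G(R(uᵢ, v_k) b_l, bⱼ) = Σ g^{kl} g^{ij} G(R(vᵢ, u_k) b_l, bⱼ)` (exchange the two
contractions and use `Rm(Y,X,W,Z) = Rm(X,Y,Z,W)`, O'Neill 1983, Ch. 3, Prop. 3.36 (1), (2)).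
[cite: ONeill1983, Ch. 3, Prop. 3.36] -/
theorem sum_ginv_ginv_apply_riemAt_comm (hG : IsMetricOn G V) (hx : x ∈ V) (u v : ι → E) :
    ∑ k, ∑ l, ginv G b x k l * ∑ i, ∑ j, ginv G b x i j *
        G x (riemAt G x (u i) (v k) (b l)) (b j) =
      ∑ k, ∑ l, ginv G b x k l * ∑ i, ∑ j, ginv G b x i j *
        G x (riemAt G x (v i) (u k) (b l)) (b j) := by
  rw [sum_ginv_mul_sum_comm b fun k l i j ↦ G x (riemAt G x (u i) (v k) (b l)) (b j)]
  refine Finset.sum_congr rfl fun k _ ↦ Finset.sum_congr rfl fun l _ ↦ ?_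
  congr 1
  refine Finset.sum_congr rfl fun i _ ↦ Finset.sum_congr rfl fun j _ ↦ ?_
  rw [riemAt_swap G x (v i) (u k), _root_.neg_apply, map_neg, _root_.neg_apply,
    hG.apply_riemAt_swap hx (v i) (u k) (b l) (b j), neg_neg]

/-- **`B(β, γ) = B(γ, β)` for symmetric `β, γ`**: the operator `γ ↦ Rm ∗ γ` of Hamilton 1982,
§7 is self-adjoint on symmetric forms, by the pair symmetry and the skew-symmetries of the
curvature tensor. [cite: Hamilton1982, §7] -/
theorem curvPair_comm (hG : IsMetricOn G V) (hx : x ∈ V) {β γ : E →L[ℝ] E →L[ℝ] ℝ}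
    (hβ : ∀ v w, β v w = β w v) (hγ : ∀ v w, γ v w = γ w v) :
    ∑ i, ∑ j, ginv G b x i j * ∑ k, b.coord k (sharpAt G x
        ((β.flip (b j)).comp (riemAt G x (b i) (sharpAt G x (γ (b k))))))
      = ∑ i, ∑ j, ginv G b x i j * ∑ k, b.coord k (sharpAt G x
        ((γ.flip (b j)).comp (riemAt G x (b i) (sharpAt G x (β (b k)))))) := by
  rw [curvPair_eq_sum_sharpAt b hG hx γ hβ, curvPair_eq_sum_sharpAt b hG hx β hγ]
  exact sum_ginv_ginv_apply_riemAt_comm b hG hx (fun i ↦ sharpAt G x (β (b i)))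
    (fun k ↦ sharpAt G x (γ (b k)))

omit [CompleteSpace E] in
/-- Linearity of the curvature pairing in its first slot:
`B(β₁ − c β₂, γ) = B(β₁, γ) − c B(β₂, γ)`. [folklore] -/
theorem curvPair_sub_smul_left (β₁ β₂ γ : E →L[ℝ] E →L[ℝ] ℝ) (c : ℝ) :
    ∑ i, ∑ j, ginv G b x i j * ∑ k, b.coord k (sharpAt G x
        (((β₁ - c • β₂).flip (b j)).comp (riemAt G x (b i) (sharpAt G x (γ (b k))))))
      = (∑ i, ∑ j, ginv G b x i j * ∑ k, b.coord k (sharpAt G x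
          ((β₁.flip (b j)).comp (riemAt G x (b i) (sharpAt G x (γ (b k)))))))
        - c * ∑ i, ∑ j, ginv G b x i j * ∑ k, b.coord k (sharpAt G x
          ((β₂.flip (b j)).comp (riemAt G x (b i) (sharpAt G x (γ (b k)))))) := by
  rw [curvPair_eq_sum b, curvPair_eq_sum b, curvPair_eq_sum b]
  simp only [_root_.sub_apply, _root_.smul_apply, smul_eq_mul, Finset.mul_sum,
    ← Finset.sum_sub_distrib]
  refine Finset.sum_congr rfl fun i _ ↦ Finset.sum_congr rfl fun j _ ↦
    Finset.sum_congr rfl fun k _ ↦ Finset.sum_congr rfl fun l _ ↦ ?_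
  ring

/-- **The traceless decomposition of the reaction term** (dimension `4`, `E = Ric − (S/4)G`):
`4B(Ric,Ric) − S|Ric|² = 4B(E,E) + S|E|²`. With `c = S/4`: `B(E,E) = B(Ric,Ric) − 2c|Ric|² + c²S`
(bilinearity, `B(G,Ric) = B(Ric,G) = |Ric|²`, `B(G,G) = ⟨Ric,G⟩ = S`) and
`|E|² = |Ric|² − 2cS + 4c²`; this is the algebra turning Hamilton's `∂ₜ|Ric|²`, `∂ₜS` reaction
terms into Huisken's form on the traceless part.
[cite: Huisken1985, Lemma 4.2] [cite: Hamilton1982, Lemma 10.5] -/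
theorem reaction_traceless_decomposition (hG : IsMetricOn G V) (hx : x ∈ V) (h4 : finrank ℝ E = 4) :
    4 * (∑ i, ∑ j, ginv G b x i j * ∑ k, b.coord k (sharpAt G x
          (((ricAt G x).flip (b j)).comp (riemAt G x (b i) (sharpAt G x (ricAt G x (b k)))))))
      - scalAt G x * normSqAt G x (ricAt G x) =
    4 * (∑ i, ∑ j, ginv G b x i j * ∑ k, b.coord k (sharpAt G x
          (((ricAt G x - (scalAt G x / 4) • G x).flip (b j)).comp
            (riemAt G x (b i) (sharpAt G x ((ricAt G x - (scalAt G x / 4) • G x) (b k)))))))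
      + scalAt G x * normSqAt G x (ricAt G x - (scalAt G x / 4) • G x) := by
  have hi := hG.isInvertible x hx
  have hs := hG.symm x hx
  have hRs : ∀ v w, ricAt G x v w = ricAt G x w v := hG.ricAt_comm hx
  have hEs : ∀ v w, (ricAt G x - (scalAt G x / 4) • G x) v w =
      (ricAt G x - (scalAt G x / 4) • G x) w v := fun v w ↦ by
    simp only [_root_.sub_apply, _root_.smul_apply, hRs v w, hs v w]
  obtain ⟨B, hB⟩ : ∃ B : (E →L[ℝ] E →L[ℝ] ℝ) → (E →L[ℝ] E →L[ℝ] ℝ) → ℝ, ∀ β γ, B β γ =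
      ∑ i, ∑ j, ginv G b x i j * ∑ k, b.coord k (sharpAt G x
        ((β.flip (b j)).comp (riemAt G x (b i) (sharpAt G x (γ (b k)))))) :=
    ⟨fun β γ ↦ ∑ i, ∑ j, ginv G b x i j * ∑ k, b.coord k (sharpAt G x
        ((β.flip (b j)).comp (riemAt G x (b i) (sharpAt G x (γ (b k)))))), fun _ _ ↦ rfl⟩
  simp only [← hB]
  -- `B(G, Ric) = |Ric|²`
  have h1 : B (G x) (ricAt G x) = normSqAt G x (ricAt G x) := by
    rw [hB, curvPair_metric_left b hG hx, pairAt_self_of_symm G x hRs]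
  -- `B(G, E) = |Ric|² − c S`
  have h2 : B (G x) (ricAt G x - (scalAt G x / 4) • G x) =
      normSqAt G x (ricAt G x) - scalAt G x / 4 * scalAt G x := by
    rw [hB, curvPair_metric_left b hG hx, pairAt_sub_right, pairAt_smul_right,
      pairAt_self_of_symm G x hRs, pairAt_metric_right hi]
    rfl
  -- `B(Ric, E) = B(E, Ric) = B(Ric, Ric) − c |Ric|²`
  have h3 : B (ricAt G x) (ricAt G x - (scalAt G x / 4) • G x) =
      B (ricAt G x) (ricAt G x) - scalAt G x / 4 * normSqAt G x (ricAt G x) := by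
    rw [hB, curvPair_comm b hG hx hRs hEs, curvPair_sub_smul_left b, ← hB, ← hB, h1]
  -- `B(E, E) = B(Ric, E) − c B(G, E)`
  have h5 : B (ricAt G x - (scalAt G x / 4) • G x) (ricAt G x - (scalAt G x / 4) • G x) =
      B (ricAt G x) (ricAt G x - (scalAt G x / 4) • G x)
        - scalAt G x / 4 * B (G x) (ricAt G x - (scalAt G x / 4) • G x) := by
    rw [hB, curvPair_sub_smul_left b, ← hB, ← hB]
  -- `|E|² = |Ric|² − 2cS + 4c²`
  have hdim : (finrank ℝ E : ℝ) = 4 := by rw [h4]; norm_num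
  have h6 : normSqAt G x (ricAt G x - (scalAt G x / 4) • G x) =
      normSqAt G x (ricAt G x) - 2 * (scalAt G x / 4) * scalAt G x
        + (scalAt G x / 4) ^ 2 * 4 := by
    rw [normSqAt_sub_smul_metric hi hs hRs, hdim]
    rfl
  rw [h5, h3, h2, h6]
  ring

end IsMetricOn

end MetricCoord

end Literature.Geometry.Lorentzian

end
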